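import Mathlib.Logic.Denumerable
import Literature.ModelTheory.Quasiminimal.LargeModels
import HarnessLib

/-!
# A directed system of closed self-embeddings of a countable quasiminimal structure

Let `M` be a countable weakly quasiminimal pregeometry structure with a basis
`b : ℕ ⊕ (ℕ ⊕ ℕ) → M` (so `M` is infinite dimensional), split as `P = b[inl ℕ]` (kept fixed),
`p = b ∘ inr ∘ inl` (spare generators) and `q = b ∘ inr ∘ inr` (vertices). The simplices
`O_l = cl (P ∪ {q_i : i < l})` of `LargeModels.lean` are then closed subsets of `M` of infinite
dimension, hence images of closed self-embeddings `ψ_l : M → M` (Kirby 2010, Thm 2.1 with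
`G = ∅`, matching the basis `b` of `M` with the basis `P ⊔ q_{<l}` of `O_l`). Conjugating the
directed system `Φ` of `LargeModels.lean` by the `ψ_l` gives, for every linear order `S`, a
**directed system of closed self-embeddings of `M` itself** indexed by the finite subsets of
`S`: `Ψ X X = id`, `Ψ Y Z ∘ Ψ X Y = Ψ X Z` (as functions), each `Ψ X Y` a partial embedding on
all of `M` with closed range, and with an element `v ∈ M` separated by the system
(`Ψ {s} {s,t} v ≠ Ψ {t} {s,t} v` for `s < t`). Every object of this system *is* `M`, so any
property of `M` transfers to the charts of its direct limit for free; the limit along a linear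
order of cardinality `κ ≥ ℵ₀` is covered by closed copies of `M` and has cardinality `κ`
(Kirby 2010, Thm 4.2; BHHKK 2014, Thm 2.3, existence).

## Contents

* `IsWeaklyQuasiminimalPregeometryStructure.exists_isQFEmbOn_onto_simplex` — the `ψ_l`.
* `IsWeaklyQuasiminimalPregeometryStructure.exists_selfEmbeddingSystem` — the system `Ψ`.

## References

* J. Kirby, *On quasiminimal excellent classes*, J. Symbolic Logic 75 (2010), Thm 2.1, Thm 4.2.
* M. Bays, B. Hart, T. Hyttinen, M. Kesälä, J. Kirby, *Quasiminimal structures and excellence*,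
  Bull. LMS 46 (2014), Thm 2.3.
-/

noncomputable section

open Set FirstOrder FirstOrder.Language

universe u v w

namespace Literature.ModelTheory.Quasiminimal

variable {L : Language.{u, v}} {M : Type w} [L.Structure M] {cl : Set M → Set M}

namespace IsWeaklyQuasiminimalPregeometryStructure

variable {b : ℕ ⊕ (ℕ ⊕ ℕ) → M}

/-- The split of a basis indexed by `ℕ ⊕ (ℕ ⊕ ℕ)`: `(p, q) = b ∘ inr` is jointly independent over
`P = b[inl ℕ]`. [folklore] -/
theorem indepFamilyOver_split (h : IsPregeometry cl) (hb : IndepFamilyOver cl ∅ b) :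
    IndepFamilyOver cl (range (b ∘ Sum.inl))
      (Sum.elim (b ∘ Sum.inr ∘ Sum.inl) (b ∘ Sum.inr ∘ Sum.inr)) := by
  intro i hi
  have helim : ∀ j : ℕ ⊕ ℕ, Sum.elim (b ∘ Sum.inr ∘ Sum.inl) (b ∘ Sum.inr ∘ Sum.inr) j =
      b (Sum.inr j) := by rintro (j | j) <;> rfl
  rw [helim] at hi
  refine hb (Sum.inr i) ?_
  rw [empty_union]
  refine h.mono ?_ hi
  rintro _ (⟨k, rfl⟩ | ⟨j, hj, rfl⟩)
  · exact ⟨Sum.inl k, (fun hh => by cases hh), rfl⟩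
  · rw [helim]
    exact ⟨Sum.inr j, fun hh => hj (Sum.inr_injective hh), rfl⟩

/-- **Closed self-embeddings onto the simplices** (Kirby 2010, Thm 2.1 with `G = ∅`): for a
countable weakly quasiminimal pregeometry structure with basis `b : ℕ ⊕ (ℕ ⊕ ℕ) → M`, there is
a partial embedding `ψ` of all of `M` onto `O_l = cl (b[inl ℕ] ∪ {q_i : i < l})`
(`q = b ∘ inr ∘ inr`) with `ψ⁻¹ (q_i)` prescribed independently of nothing — we only record that
`ψ` is a partial embedding on `univ` with image `O_l`. [cite: Kirby2010QMEC, Thm 2.1] -/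
theorem exists_isQFEmbOn_onto_simplex [Countable M]
    (hW : IsWeaklyQuasiminimalPregeometryStructure L M cl) (hb : IndepFamilyOver cl ∅ b)
    (hsp : cl (range b) = univ) (l : ℕ) :
    ∃ ψ : M → M, IsQFEmbOn L ψ univ ∧
      ψ '' univ = cl (range (b ∘ Sum.inl) ∪ (b ∘ Sum.inr ∘ Sum.inr) '' {i | i < l}) := by
  classical
  have hP := hW.isPregeometry
  -- reindex the basis by `ℕ`
  let e : ℕ ≃ ℕ ⊕ (ℕ ⊕ ℕ) := (Denumerable.eqv (ℕ ⊕ (ℕ ⊕ ℕ))).symm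
  let u : ℕ → M := b ∘ e
  -- the target basis `q_{<l} ⊔ P`
  let g : ℕ → ℕ ⊕ (ℕ ⊕ ℕ) := fun j => if j < l then Sum.inr (Sum.inr j) else Sum.inl (j - l)
  have hg : Function.Injective g := by
    intro a c h
    by_cases ha : a < l <;> by_cases hc : c < l <;> simp [g, ha, hc] at h <;> omega
  let u' : ℕ → M := b ∘ g
  have hu : IndepFamilyOver cl ∅ u := hb.comp_equiv e
  have hu' : IndepFamilyOver cl (id '' ∅) u' := by
    rw [image_empty]
    intro j hj
    refine hb (g j) ?_
    rw [empty_union] at hj ⊢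
    refine hP.mono ?_ hj
    rintro _ ⟨k, hk, rfl⟩
    exact ⟨g k, fun hh => hk (hg hh), rfl⟩
  obtain ⟨F, hF, -, -, hFim⟩ := hW.exists_isQFEmbOn_extend_indepFamily (G := ∅) (f := id)
    (Or.inr rfl) (IsQFEmbOn.id ∅) hu hu'
  have hru : range u = range b := by
    simp only [u, EquivLike.range_comp]
  have hdom : cl (∅ ∪ range u) = univ := by rw [empty_union, hru, hsp]
  have hru' : range u' = range (b ∘ Sum.inl) ∪ (b ∘ Sum.inr ∘ Sum.inr) '' {i | i < l} := by
    ext y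
    simp only [u', g, mem_range, Function.comp_apply, mem_union, mem_image, mem_setOf_eq]
    constructor
    · rintro ⟨j, rfl⟩
      by_cases hj : j < l
      · rw [if_pos hj]; exact Or.inr ⟨j, hj, rfl⟩
      · rw [if_neg hj]; exact Or.inl ⟨j - l, rfl⟩
    · rintro (⟨k, rfl⟩ | ⟨i, hi, rfl⟩)
      · refine ⟨k + l, ?_⟩
        rw [if_neg (by omega), Nat.add_sub_cancel]
      · exact ⟨i, by rw [if_pos hi]⟩
  rw [hdom] at hF hFim
  rw [image_empty, empty_union, hru'] at hFim
  exact ⟨F, hF, hFim⟩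

/-- **The directed system of closed self-embeddings of `M`** over the finite subsets of a linear
order (Kirby 2010, Thm 4.2 / BHHKK 2014, Thm 2.3, existence half — combinatorial form with all
objects equal to the countable model `M`). [cite: Kirby2010QMEC, Thm 4.2] -/
theorem exists_selfEmbeddingSystem [Countable M]
    (hW : IsWeaklyQuasiminimalPregeometryStructure L M cl) (hb : IndepFamilyOver cl ∅ b)
    (hsp : cl (range b) = univ) (S : Type*) [LinearOrder S] :
    ∃ Ψ : Finset S → Finset S → M → M,
      (∀ X : Finset S, Ψ X X = id) ∧
      (∀ X Y Z : Finset S, X ⊆ Y → Y ⊆ Z → Ψ Y Z ∘ Ψ X Y = Ψ X Z) ∧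
      (∀ X Y : Finset S, X ⊆ Y → IsQFEmbOn L (Ψ X Y) univ) ∧
      (∀ X Y : Finset S, X ⊆ Y → cl (range (Ψ X Y)) = range (Ψ X Y)) ∧
      ∃ v : M, ∀ s t : S, s < t → Ψ {s} {s, t} v ≠ Ψ {t} {s, t} v := by
  classical
  have hP := hW.isPregeometry
  haveI : Nonempty M := ⟨b (Sum.inl 0)⟩
  set P : Set M := range (b ∘ Sum.inl) with hPdef
  set p : ℕ → M := b ∘ Sum.inr ∘ Sum.inl with hpdef
  set q : ℕ → M := b ∘ Sum.inr ∘ Sum.inr with hqdef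
  have hpq : IndepFamilyOver cl P (Sum.elim p q) := indepFamilyOver_split hP hb
  -- the simplices and the embeddings onto them
  set O : ℕ → Set M := fun l => cl (P ∪ (q '' {i | i < l})) with hO
  have hO_cl : ∀ l, cl (O l) = O l := fun l => hP.cl_cl _
  have hψex : ∀ l, ∃ ψ : M → M, IsQFEmbOn L ψ univ ∧ ψ '' univ = O l := fun l =>
    hW.exists_isQFEmbOn_onto_simplex hb hsp l
  choose ψ hψ hψim using hψex
  let ψi : ℕ → M → M := fun l => Function.invFunOn (ψ l) univ
  have hψiψ : ∀ l z, ψi l (ψ l z) = z := fun l z =>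
    (hψ l).injOn.leftInvOn_invFunOn (mem_univ z)
  have hψψi : ∀ l, ∀ y ∈ O l, ψ l (ψi l y) = y := fun l y hy => by
    obtain ⟨z, -, rfl⟩ : y ∈ ψ l '' univ := by rw [hψim]; exact hy
    rw [hψiψ]
  have hψmem : ∀ l z, ψ l z ∈ O l := fun l z => by
    rw [← hψim l]; exact mem_image_of_mem _ (mem_univ z)
  have hψi_emb : ∀ l, IsQFEmbOn L (ψi l) (O l) := fun l => by
    have := (hψ l).inverse (fun z _ => hψiψ l z); rwa [hψim] at this
  have hψi_im : ∀ l, ψi l '' O l = univ := fun l => by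
    rw [← hψim l]
    exact (hψ l).injOn.leftInvOn_invFunOn.image_image
  -- the system on the simplices
  obtain ⟨Φ, hΦid, hΦcomp, hΦemb, hΦmaps, hΦim, hΦvert⟩ := hW.exists_finsetSystem hpq S
  refine ⟨fun X Y => ψi Y.card ∘ Φ X Y ∘ ψ X.card, fun X => ?_, fun X Y Z hXY hYZ => ?_,
    fun X Y hXY => ?_, fun X Y hXY => ?_, ⟨ψi 1 (q 0), fun s t hst => ?_⟩⟩
  · funext z
    simp only [Function.comp_apply, id_eq]
    rw [hΦid X _ (hψmem _ z), hψiψ]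
  · funext z
    simp only [Function.comp_apply]
    rw [hψψi _ _ (hΦmaps X Y hXY (hψmem _ z)), hΦcomp X Y Z hXY hYZ _ (hψmem _ z)]
  · show IsQFEmbOn L (ψi Y.card ∘ (Φ X Y ∘ ψ X.card)) univ
    refine ((hψ X.card).comp ?_).comp ?_
    · rw [hψim]; exact hΦemb X Y hXY
    · rw [image_comp, hψim]
      exact (hψi_emb Y.card).mono (hΦmaps X Y hXY).image_subset
  · obtain ⟨I, -, hI⟩ := hΦim X Y hXY
    have hrange : range (ψi Y.card ∘ Φ X Y ∘ ψ X.card) = ψi Y.card '' cl (P ∪ (q '' I)) := by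
      rw [← image_univ, image_comp, image_comp, hψim, hI]
    have hsubO : cl (P ∪ (q '' I)) ⊆ O Y.card := by
      rw [← hI]; exact (hΦmaps X Y hXY).image_subset
    rw [hrange, (hψi_emb Y.card).image_cl_eq hW (X := P ∪ q '' I) hsubO
      (by rw [hψi_im]; exact subset_univ _), hP.cl_cl]
  · obtain ⟨h1, h2⟩ := hΦvert s t hst
    simp only [Function.comp_apply, Finset.card_singleton]
    have hq0 : q 0 ∈ O 1 := hP.subset_cl _ (Or.inr ⟨0, Nat.one_pos, rfl⟩)
    rw [hψψi 1 _ hq0, h1, h2]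
    have hcard : ({s, t} : Finset S).card = 2 := Finset.card_pair (ne_of_lt hst)
    rw [hcard]
    have hq0' : q 0 ∈ O 2 := hP.subset_cl _ (Or.inr ⟨0, (by omega : 0 < 2), rfl⟩)
    have hq1' : q 1 ∈ O 2 := hP.subset_cl _ (Or.inr ⟨1, (by omega : 1 < 2), rfl⟩)
    intro heq
    have := (hψi_emb 2).injOn hq0' hq1' heq
    have hq01 : q 0 ≠ q 1 := fun h => by
      have key := hpq.injective hP
        (show Sum.elim p q (Sum.inr 0) = Sum.elim p q (Sum.inr 1) by simpa using h)
      exact Nat.zero_ne_one (Sum.inr_injective key)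
    exact hq01 this

end IsWeaklyQuasiminimalPregeometryStructure

end Literature.ModelTheory.Quasiminimal

end
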